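import Summits.RiemannHypothesis.RiemannHypothesis.Theorems.MotivicDoorFfCliff
import Mathlib.RingTheory.MvPolynomial.Symmetric.NewtonIdentities
import Mathlib.RingTheory.Polynomial.Vieta

/-!
# Motivic door, ff calibration: the LATTICE FLOOR under the window determinant
(pub-rhdoor, unit `ffcal`, HOME/FFCAL.md §3 bound B2; seat planner-pub-rhdoor-ffcal-g2-0; revised by seat
planner-pub-rhdoor-ffcal-g3-0: the floors now hold on EVERY pre-cliff window, repeated roots allowed; no
landed statement changed)

HONEST FRAMING (cell charter, verbatim): lottery ticket at the motivic door; RH probability negligible;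
consolation prizes are real: a new semi-local Weil-positivity theorem, or a located gap in the
Connes–Consani programme, plus the ff-door theorem.  Nothing in this file is a statement about `ζ`.

Setting of `PfPersistenceFfAngleTwin` (pub-weilobs `FF.md` §1): datum `(q, A)` (`A = frobRoots h` for
Frobenius), `s_n(A) = Σ_{α ∈ A} α^n`, `K(n) = s_n / (2 q^{n/2})`, `T_M = (K(|m - m'|))_{m, m' ≤ M}`
(`ffWindowForm q A M`, `weilWindowForm q h M`).  Proved here ([folklore] algebra; FFCAL.md §3 "B2"):
* `powerSum_frobRoots_mem_intRange`: for MONIC `h ∈ ℤ[x]` every `s_n(frobRoots h)` is an integer — Newton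
  (`MvPolynomial.psum_eq_mul_esymm_sub_sum`) over Vieta (`Polynomial.coeff_eq_esymm_roots_of_card`).
* `latticeMatrix_eq`, `det_latticeMatrix`, `det_latticeMatrix_frobRoots_mem_intRange`: the LATTICE MATRIX
  `S_M := (q^{min(m,m')} · s_{|m-m'|}(A))_{m,m'} = D (2 T_M) D`, `D = diag((√q)^m)`; so
  `det S_M = q^{Σ_{m ≤ M} m} · 2^{M+1} · det T_M`, an integer for monic `h` and natural `q`.
* `one_le_det_weilWindowForm_mul_of_posDef` (THE LATTICE FLOOR, determinant form): if `T_M(q, h) ≻ 0` the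
  integer `det S_M` is `≥ 1`: `1 ≤ q^{Σ_{m ≤ M} m} · 2^{M+1} · det T_M` — pre-cliff window determinants of
  genuine Frobenius data sit on an integer lattice, uniformly in the datum (the archimedean Weil form has no
  such lattice, FFCAL.md §8).  Definiteness holds under function-field RH (all roots of absolute value `√q`)
  on PRE-CLIFF windows: `one_le_det_weilWindowForm_mul` (roots pairwise distinct, `M + 1 ≤ deg h`) and
  `one_le_det_weilWindowForm_mul_of_le_card` (ANY multiplicities, `M + 1 ≤ D` = number of DISTINCT roots, via
  `MotivicDoorFfCliff.weilWindowForm_posDef_iff`; sharp: `det T_M = 0` for `M ≥ D`).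
* `weilWindowForm_sub_latticeFloor_posSemidef_of_posDef` / `…_posSemidef` / `…_posSemidef_of_le_card`
  (Loewner form): under the same hypotheses `T_M - c · 1 ⪰ 0`, `c = latticeFloor q (deg h) M =
  (2^{M+1} q^{Σ_{m ≤ M} m})⁻¹ (2M / ((M+1) deg h))^M = ½ q^{-M(M+1)/2} (M / (2g(M+1)))^M` (`deg h = 2g`), by
  `tr T_M = (M+1) deg h / 2` (`trace_ffWindowForm`) and AM–GM `λ_min ≥ det · (M / tr)^M`.
DATA context (not used in any proof): on the 2332 pre-cliff windows (`M + 1 ≤ D`; 2122 with simple roots)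
of the 505 exact objects of the ff calibration, `det S_M ≥ 1` exactly (1 … 2033 digits, two engines;
FFCAL.md §0 A6, §10 D10).  No RH claim in either direction.
-/

set_option linter.dupNamespace false  -- the mandated namespace repeats `RiemannHypothesis`

noncomputable section

open Polynomial Matrix Finset
open scoped ComplexOrder ComplexConjugate

namespace Summit.RiemannHypothesis.RiemannHypothesis.Theorems.MotivicDoor.FfLatticeFloor

open Summit.RiemannHypothesis.RiemannHypothesis.Theorems.PfPersistence.FfAngleTwin
open Summit.RiemannHypothesis.RiemannHypothesis.Theorems.MotivicDoor.FfCliff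

/-- The subring of (casts of) integers in `ℂ`. [folklore] -/
abbrev intRange : Subring ℂ := (Int.castRingHom ℂ).range

/-- Membership in `intRange`: `z` is the cast of an integer. [folklore] -/
theorem mem_intRange_iff {z : ℂ} : z ∈ intRange ↔ ∃ n : ℤ, (n : ℂ) = z := by
  simp [intRange, RingHom.mem_range]

/-- VIETA: the elementary symmetric functions of the complex roots of a MONIC integer polynomial are
integers: `e_j(frobRoots h) = (-1)^j · h_{deg h - j}` for `j ≤ deg h`, and `0` beyond. [folklore] -/
theorem esymm_frobRoots_mem_intRange {h : ℤ[X]} (hmon : h.Monic) (j : ℕ) :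
    (frobRoots h).esymm j ∈ intRange := by
  rw [mem_intRange_iff]
  set p : ℂ[X] := h.map (Int.castRingHom ℂ) with hp
  have hpm : p.Monic := hmon.map _
  have hdeg : p.natDegree = h.natDegree := hmon.natDegree_map _
  have hroots : frobRoots h = p.roots := rfl
  have hcard : Multiset.card p.roots = p.natDegree := by
    rw [← hroots, card_frobRoots_eq_natDegree, hdeg]
  by_cases hj : j ≤ h.natDegree
  · -- Vieta at `k = deg - j`
    have hk : h.natDegree - j ≤ p.natDegree := by rw [hdeg]; exact Nat.sub_le _ _
    have hv := Polynomial.coeff_eq_esymm_roots_of_card hcard hk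
    rw [hpm.leadingCoeff, one_mul, hdeg, Nat.sub_sub_self hj, ← hroots] at hv
    refine ⟨(-1) ^ j * h.coeff (h.natDegree - j), ?_⟩
    have hs : ((-1 : ℂ) ^ j) * ((-1 : ℂ) ^ j) = 1 := by
      rw [← pow_add, ← two_mul, pow_mul]; norm_num
    calc ((((-1) ^ j * h.coeff (h.natDegree - j) : ℤ)) : ℂ)
        = (-1 : ℂ) ^ j * p.coeff (h.natDegree - j) := by
          rw [hp, Polynomial.coeff_map, eq_intCast]; push_cast; ring
      _ = (-1 : ℂ) ^ j * ((-1 : ℂ) ^ j * (frobRoots h).esymm j) := by rw [hv]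
      _ = (frobRoots h).esymm j := by rw [← mul_assoc, hs, one_mul]
  · refine ⟨0, ?_⟩
    push Not at hj
    rw [Multiset.esymm, Multiset.powersetCard_eq_empty _ (by rw [card_frobRoots_eq_natDegree]; exact hj)]
    simp

/-- NEWTON: every power sum `s_n(frobRoots h)` of the complex roots of a MONIC integer polynomial is an
integer. [folklore] -/
theorem powerSum_frobRoots_mem_intRange {h : ℤ[X]} (hmon : h.Monic) (n : ℕ) :
    powerSum (frobRoots h) n ∈ intRange := by
  classical
  obtain ⟨k, u, hU⟩ := exists_eq_univ_val_map (frobRoots h)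
  have hes : ∀ j, MvPolynomial.aeval u (MvPolynomial.esymm (Fin k) ℤ j) = (frobRoots h).esymm j := by
    intro j; rw [MvPolynomial.aeval_esymm_eq_multiset_esymm, hU]
  have hps : ∀ j, MvPolynomial.aeval u (MvPolynomial.psum (Fin k) ℤ j) = powerSum (frobRoots h) j := by
    intro j
    simp only [MvPolynomial.psum, map_sum, map_pow, MvPolynomial.aeval_X]
    rw [sum_univ_eq_multiset_sum hU (fun z => z ^ j)]; rfl
  induction n using Nat.strong_induction_on with
  | _ n ih =>
    rcases Nat.eq_zero_or_pos n with hn | hn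
    · subst hn
      rw [powerSum_zero, mem_intRange_iff]
      exact ⟨Multiset.card (frobRoots h), by simp⟩
    · have hnewton := congrArg (MvPolynomial.aeval u) (MvPolynomial.psum_eq_mul_esymm_sub_sum (Fin k) ℤ n hn)
      rw [hps] at hnewton
      rw [hnewton, map_sub, map_mul, map_mul, map_sum]
      refine Subring.sub_mem _ (Subring.mul_mem _ (Subring.mul_mem _ ?_ ?_) (hes n ▸ esymm_frobRoots_mem_intRange hmon n)) ?_
      · rw [map_pow, map_neg, map_one]; exact Subring.pow_mem _ (Subring.neg_mem _ (Subring.one_mem _)) _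
      · rw [map_natCast]; exact natCast_mem _ n
      · refine Subring.sum_mem _ fun a ha => ?_
        simp only [Finset.mem_filter, Finset.HasAntidiagonal.mem_antidiagonal, Set.mem_Ioo] at ha
        obtain ⟨hsum, hlo, hhi⟩ := ha
        rw [map_mul, map_mul, map_pow, map_neg, map_one, hes, hps]
        refine Subring.mul_mem _ (Subring.mul_mem _ (Subring.pow_mem _ (Subring.neg_mem _ (Subring.one_mem _)) _)
          (esymm_frobRoots_mem_intRange hmon _)) (ih _ ?_)
        omega

/-- The integer values `z_n` with `s_n(frobRoots h) = z_n` (a choice; `powerSum_frobRoots_mem_intRange`). -/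
theorem exists_int_powerSum_frobRoots {h : ℤ[X]} (hmon : h.Monic) :
    ∃ z : ℕ → ℤ, ∀ n, powerSum (frobRoots h) n = (z n : ℂ) := by
  have hx : ∀ n, ∃ zn : ℤ, (zn : ℂ) = powerSum (frobRoots h) n :=
    fun n => mem_intRange_iff.1 (powerSum_frobRoots_mem_intRange hmon n)
  choose z hz using hx
  exact ⟨z, fun n => (hz n).symm⟩

/-- The LATTICE MATRIX `S_M(q, A) = (q^{min(m,m')} · s_{|m-m'|}(A))_{0 ≤ m,m' ≤ M}`. [folklore] -/
def latticeMatrix (q : ℕ) (A : Multiset ℂ) (M : ℕ) : Matrix (Fin (M + 1)) (Fin (M + 1)) ℂ :=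
  Matrix.of fun m m' => (q : ℂ) ^ min (m : ℕ) m' * powerSum A (Nat.dist m m')

/-- The diagonal rescaling `D = diag((√q)^m)_{0 ≤ m ≤ M}`. [folklore] -/
def sqrtDiag (q : ℕ) (M : ℕ) : Matrix (Fin (M + 1)) (Fin (M + 1)) ℂ :=
  diagonal fun m => (Real.sqrt q : ℂ) ^ (m : ℕ)

/-- `|m - m'| + 2 min(m, m') = m + m'`. [folklore] -/
theorem dist_add_two_mul_min (m m' : ℕ) : Nat.dist m m' + 2 * min m m' = m + m' := by
  rcases le_total m m' with h | h
  · rw [Nat.dist_eq_sub_of_le h, min_eq_left h]; omega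
  · rw [Nat.dist_eq_sub_of_le_right h, min_eq_right h]; omega

/-- `S_M = D (2 T_M) D`. [folklore] -/
theorem latticeMatrix_eq {q : ℕ} (hq : 0 < q) (A : Multiset ℂ) (M : ℕ) :
    latticeMatrix q A M = sqrtDiag q M * ((2 : ℂ) • ffWindowForm q A M) * sqrtDiag q M := by
  have hs : (Real.sqrt q : ℂ) ≠ 0 := by
    exact_mod_cast (Real.sqrt_pos.2 (by exact_mod_cast hq : (0 : ℝ) < q)).ne'
  have hsq : (Real.sqrt q : ℂ) ^ 2 = (q : ℂ) := by
    rw [← Complex.ofReal_pow, Real.sq_sqrt (by positivity)]; push_cast; rfl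
  ext m m'
  simp only [latticeMatrix, sqrtDiag, ffWindowForm, Matrix.of_apply, mul_diagonal, diagonal_mul,
    Matrix.smul_apply, smul_eq_mul]
  rw [ffKernel_eq]
  -- `(√q)^m · (2 · s / (2 (√q)^d)) · (√q)^{m'} = q^{min} · s` with `d + 2 min = m + m'`
  have hpow : (Real.sqrt q : ℂ) ^ (m : ℕ) * (Real.sqrt q : ℂ) ^ (m' : ℕ)
      = (Real.sqrt q : ℂ) ^ Nat.dist m m' * (q : ℂ) ^ min (m : ℕ) m' := by
    rw [← pow_add, ← dist_add_two_mul_min, pow_add, pow_mul, hsq]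
  have hd : (Real.sqrt q : ℂ) ^ Nat.dist m m' ≠ 0 := pow_ne_zero _ hs
  have key : (Real.sqrt q : ℂ) ^ (m : ℕ)
        * (2 * (powerSum A (Nat.dist m m') / (2 * (Real.sqrt q : ℂ) ^ Nat.dist m m')))
        * (Real.sqrt q : ℂ) ^ (m' : ℕ)
      = (Real.sqrt q : ℂ) ^ (m : ℕ) * (Real.sqrt q : ℂ) ^ (m' : ℕ) * powerSum A (Nat.dist m m')
        / (Real.sqrt q : ℂ) ^ Nat.dist m m' := by
    field_simp
  rw [key, hpow, mul_assoc, mul_div_cancel_left₀ _ hd]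

/-- `det D = (√q)^{Σ m}`. [folklore] -/
theorem det_sqrtDiag (q M : ℕ) :
    (sqrtDiag q M).det = (Real.sqrt q : ℂ) ^ (∑ m : Fin (M + 1), (m : ℕ)) := by
  rw [sqrtDiag, det_diagonal, Finset.prod_pow_eq_pow_sum]

/-- `det S_M = q^{Σ_{m ≤ M} m} · 2^{M+1} · det T_M`. [folklore] -/
theorem det_latticeMatrix {q : ℕ} (hq : 0 < q) (A : Multiset ℂ) (M : ℕ) :
    (latticeMatrix q A M).det
      = (q : ℂ) ^ (∑ m : Fin (M + 1), (m : ℕ)) * 2 ^ (M + 1) * (ffWindowForm q A M).det := by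
  have hsq : (Real.sqrt q : ℂ) ^ 2 = (q : ℂ) := by
    rw [← Complex.ofReal_pow, Real.sq_sqrt (by positivity)]; push_cast; rfl
  rw [latticeMatrix_eq hq, det_mul, det_mul, det_smul, Fintype.card_fin, det_sqrtDiag]
  have : (Real.sqrt q : ℂ) ^ (∑ m : Fin (M + 1), (m : ℕ)) * (Real.sqrt q : ℂ) ^ (∑ m : Fin (M + 1), (m : ℕ))
      = (q : ℂ) ^ (∑ m : Fin (M + 1), (m : ℕ)) := by
    rw [← pow_two, ← pow_mul, mul_comm, pow_mul, hsq]
  rw [← this]; ring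

/-- The exponent in closed form: `Σ_{m ≤ M} m = M (M + 1) / 2`. [folklore] -/
theorem sum_fin_val_eq (M : ℕ) : (∑ m : Fin (M + 1), (m : ℕ)) = M * (M + 1) / 2 := by
  rw [Fin.sum_univ_eq_sum_range (fun i => i) (M + 1), Finset.sum_range_id, Nat.add_sub_cancel, Nat.mul_comm]

/-- For MONIC `h ∈ ℤ[x]` and natural `q` the lattice matrix of `(q, frobRoots h)` has integer entries:
it is the cast of the integer matrix `(q^{min(m,m')} z_{|m-m'|})`. [folklore] -/
theorem latticeMatrix_frobRoots_eq_map {h : ℤ[X]} {z : ℕ → ℤ}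
    (hz : ∀ n, powerSum (frobRoots h) n = (z n : ℂ)) (q M : ℕ) :
    latticeMatrix q (frobRoots h) M
      = (Matrix.of fun m m' : Fin (M + 1) => (q : ℤ) ^ min (m : ℕ) m' * z (Nat.dist m m')).map
          (Int.castRingHom ℂ) := by
  ext m m'
  simp [latticeMatrix, hz]

/-- Hence `det S_M(q, frobRoots h)` is an integer. [folklore] -/
theorem det_latticeMatrix_frobRoots_mem_intRange {h : ℤ[X]} (hmon : h.Monic) (q M : ℕ) :
    (latticeMatrix q (frobRoots h) M).det ∈ intRange := by
  obtain ⟨z, hz⟩ := exists_int_powerSum_frobRoots hmon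
  rw [latticeMatrix_frobRoots_eq_map hz, mem_intRange_iff]
  exact ⟨_, by rw [← RingHom.mapMatrix_apply, ← RingHom.map_det]; rfl⟩

/-- A positive complex number (in the star order: real and `> 0`) that is an integer is `≥ 1`. [folklore] -/
theorem one_le_re_of_pos_of_mem_intRange {w : ℂ} (hpos : 0 < w) (hint : w ∈ intRange) : 1 ≤ w.re := by
  obtain ⟨N, rfl⟩ := mem_intRange_iff.1 hint
  rw [Complex.lt_def] at hpos
  obtain ⟨hre, -⟩ := hpos
  rw [Complex.zero_re, Complex.intCast_re] at hre
  rw [Complex.intCast_re]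
  exact_mod_cast (show (1 : ℤ) ≤ N by exact_mod_cast hre)

/-- LATTICE FLOOR, determinant form, from definiteness: MONIC `h ∈ ℤ[x]`, `q ≥ 1`, `T_M(q, h) ≻ 0` ⇒
`1 ≤ q^{Σ_{m ≤ M} m} · 2^{M+1} · det T_M(q, h)` (the positive integer `det S_M`). [folklore] -/
theorem one_le_det_weilWindowForm_mul_of_posDef {q : ℕ} (hq : 0 < q) {h : ℤ[X]} (hmon : h.Monic)
    {M : ℕ} (hpd : (weilWindowForm q h M).PosDef) :
    1 ≤ (q : ℝ) ^ (∑ m : Fin (M + 1), (m : ℕ)) * 2 ^ (M + 1) * (weilWindowForm q h M).det.re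
      ∧ (weilWindowForm q h M).det.im = 0 := by
  classical
  have hdetpos : 0 < (weilWindowForm (q : ℝ) h M).det := hpd.det_pos
  have hdet := det_latticeMatrix hq (frobRoots h) M
  have hw : weilWindowForm (q : ℝ) h M = ffWindowForm q (frobRoots h) M := rfl
  rw [← hw] at hdet
  have hc : (q : ℂ) ^ (∑ m : Fin (M + 1), (m : ℕ)) * 2 ^ (M + 1)
      = (((q : ℝ) ^ (∑ m : Fin (M + 1), (m : ℕ)) * 2 ^ (M + 1) : ℝ) : ℂ) := by push_cast; rfl
  have hcpos : (0 : ℝ) < (q : ℝ) ^ (∑ m : Fin (M + 1), (m : ℕ)) * 2 ^ (M + 1) := by positivity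
  have hSpos : 0 < (latticeMatrix q (frobRoots h) M).det := by
    rw [hdet, hc]
    exact mul_pos (Complex.zero_lt_real.2 hcpos) hdetpos
  have h1 := one_le_re_of_pos_of_mem_intRange hSpos (det_latticeMatrix_frobRoots_mem_intRange hmon q M)
  rw [hdet, hc, Complex.re_ofReal_mul] at h1
  refine ⟨h1, ?_⟩
  have := (Complex.lt_def.1 hdetpos).2
  rw [Complex.zero_im] at this
  exact this.symm

/-- THE LATTICE FLOOR (FFCAL.md §3 B2, determinant form): MONIC `h ∈ ℤ[x]`, all roots of absolute value
`√q` and pairwise distinct, `M + 1 ≤ deg h` ⇒ `1 ≤ q^{Σ_{m ≤ M} m} · 2^{M+1} · det T_M`. [folklore] -/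
theorem one_le_det_weilWindowForm_mul {q : ℕ} (hq : 0 < q) {h : ℤ[X]} (hmon : h.Monic)
    (hRH : ∀ α ∈ frobRoots h, ‖α‖ = Real.sqrt q) (hnodup : (frobRoots h).Nodup)
    {M : ℕ} (hM : M + 1 ≤ h.natDegree) :
    1 ≤ (q : ℝ) ^ (∑ m : Fin (M + 1), (m : ℕ)) * 2 ^ (M + 1) * (weilWindowForm q h M).det.re
      ∧ (weilWindowForm q h M).det.im = 0 :=
  one_le_det_weilWindowForm_mul_of_posDef hq hmon
    (weilWindowForm_posDef (by exact_mod_cast hq) hRH hnodup hM)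

/-- AM–GM for a finite family of nonnegative reals: `∏_{j ∈ s} x_j ≤ ((Σ_{j ∈ s} x_j) / #s) ^ #s`. [folklore] -/
theorem prod_le_pow_sum_div_card {ι : Type*} (s : Finset ι) (x : ι → ℝ) (hx : ∀ j ∈ s, 0 ≤ x j) :
    ∏ j ∈ s, x j ≤ ((∑ j ∈ s, x j) / s.card) ^ s.card := by
  rcases s.eq_empty_or_nonempty with rfl | hne
  · simp
  have hc : (0 : ℝ) < s.card := by exact_mod_cast hne.card_pos
  have hcn : s.card ≠ 0 := hne.card_pos.ne'
  have h := Real.geom_mean_le_arith_mean_weighted s (fun _ => (s.card : ℝ)⁻¹) x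
    (fun _ _ => by positivity) (by rw [Finset.sum_const, nsmul_eq_mul, mul_inv_cancel₀ hc.ne']) hx
  have hl : 0 ≤ ∏ j ∈ s, x j ^ (s.card : ℝ)⁻¹ :=
    Finset.prod_nonneg fun j hj => Real.rpow_nonneg (hx j hj) _
  have h2 := pow_le_pow_left₀ hl h s.card
  have hpow : (∏ j ∈ s, x j ^ (s.card : ℝ)⁻¹) ^ s.card = ∏ j ∈ s, x j := by
    rw [← Finset.prod_pow]
    exact Finset.prod_congr rfl fun j hj => Real.rpow_inv_natCast_pow (hx j hj) hcn
  have hsum : ∑ j ∈ s, (s.card : ℝ)⁻¹ * x j = (∑ j ∈ s, x j) / s.card := by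
    rw [← Finset.mul_sum, inv_mul_eq_div]
  rwa [hpow, hsum] at h2

/-- EIGENVALUE FLOOR FROM THE DETERMINANT: for a positive definite matrix of size `M + 1` with real
eigenvalues `λ_j`, every eigenvalue satisfies `(∏_j λ_j) · (M / Σ_j λ_j)^M ≤ λ_i`
(`λ_i = det / ∏_{j ≠ i} λ_j` and AM–GM on the other `M` eigenvalues, whose sum is at most the trace). [folklore] -/
theorem prod_mul_pow_le_eigenvalues {M : ℕ} {A : Matrix (Fin (M + 1)) (Fin (M + 1)) ℂ} (hA : A.PosDef)
    (i : Fin (M + 1)) :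
    (∏ j, hA.1.eigenvalues j) * ((M : ℝ) / ∑ j, hA.1.eigenvalues j) ^ M ≤ hA.1.eigenvalues i := by
  classical
  set lam := hA.1.eigenvalues with hlam
  have hpos : ∀ j, 0 < lam j := hA.eigenvalues_pos
  set P := ∏ j ∈ Finset.univ.erase i, lam j with hP
  set t := ∑ j, lam j with ht
  have hPpos : 0 < P := Finset.prod_pos fun j _ => hpos j
  have htpos : 0 < t := Finset.sum_pos (fun j _ => hpos j) Finset.univ_nonempty
  have hprod : ∏ j, lam j = lam i * P := (Finset.mul_prod_erase _ _ (Finset.mem_univ i)).symm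
  have hcard : (Finset.univ.erase i).card = M := by
    rw [Finset.card_erase_of_mem (Finset.mem_univ i), Finset.card_univ, Fintype.card_fin]; rfl
  have hPle : P ≤ (t / M) ^ M := by
    have h1 := prod_le_pow_sum_div_card (Finset.univ.erase i) lam (fun j _ => (hpos j).le)
    rw [hcard] at h1
    have hsnn : 0 ≤ ∑ j ∈ Finset.univ.erase i, lam j := Finset.sum_nonneg fun j _ => (hpos j).le
    refine h1.trans (pow_le_pow_left₀ (div_nonneg hsnn (Nat.cast_nonneg M)) ?_ M)
    have hsub : ∑ j ∈ Finset.univ.erase i, lam j ≤ t :=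
      Finset.sum_le_sum_of_subset_of_nonneg (Finset.erase_subset _ _) fun j _ _ => (hpos j).le
    exact div_le_div_of_nonneg_right hsub (Nat.cast_nonneg M)
  have hone : (t / M) ^ M * ((M : ℝ) / t) ^ M = 1 := by
    rcases Nat.eq_zero_or_pos M with hM | hM
    · subst hM; simp
    · rw [← mul_pow, div_mul_div_comm, mul_comm t, div_self (by positivity), one_pow]
  calc (∏ j, lam j) * ((M : ℝ) / t) ^ M = lam i * (P * ((M : ℝ) / t) ^ M) := by rw [hprod]; ring
    _ ≤ lam i * ((t / M) ^ M * ((M : ℝ) / t) ^ M) :=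
        mul_le_mul_of_nonneg_left (mul_le_mul_of_nonneg_right hPle (by positivity)) (hpos i).le
    _ = lam i := by rw [hone, mul_one]

/-- LOEWNER FORM: a Hermitian matrix all of whose eigenvalues are `≥ c` dominates `c · 1`:
`A - c • 1 ⪰ 0` (spectral theorem). [folklore] -/
theorem posSemidef_sub_smul_one_of_le_eigenvalues {n : Type*} [Fintype n] [DecidableEq n]
    {A : Matrix n n ℂ} (hA : A.IsHermitian) {c : ℝ} (hc : ∀ i, c ≤ hA.eigenvalues i) :
    (A - (c : ℂ) • (1 : Matrix n n ℂ)).PosSemidef := by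
  set U := hA.eigenvectorUnitary with hU
  have key : A - (c : ℂ) • (1 : Matrix n n ℂ)
      = Unitary.conjStarAlgAut ℂ _ U (diagonal fun i => ((hA.eigenvalues i - c : ℝ) : ℂ)) := by
    conv_lhs => rw [hA.spectral_theorem]
    rw [← hU, ← map_one (Unitary.conjStarAlgAut ℂ (Matrix n n ℂ) U), ← map_smul, ← map_sub]
    congr 1
    ext i j
    simp only [Matrix.sub_apply, diagonal_apply, Matrix.smul_apply, Matrix.one_apply, Function.comp_apply,
      smul_eq_mul]
    split_ifs with hij
    · push_cast; simp [RCLike.ofReal_alg]  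
    · simp
  rw [key, Unitary.conjStarAlgAut_apply, Unitary.isUnit_coe.posSemidef_star_right_conjugate_iff,
    posSemidef_diagonal_iff]
  intro i
  exact Complex.zero_le_real.2 (sub_nonneg.2 (hc i))

/-- Trace of the window form: `tr T_M = (M + 1) · K(0) = (M + 1) · #A / 2`. [folklore] -/
theorem trace_ffWindowForm (q : ℝ) (A : Multiset ℂ) (M : ℕ) :
    (ffWindowForm q A M).trace = (M + 1 : ℂ) * (Multiset.card A : ℂ) / 2 := by
  simp only [Matrix.trace, Matrix.diag, ffWindowForm, Matrix.of_apply, Nat.dist_self, ffKernel_zero,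
    Finset.sum_const, Finset.card_univ, Fintype.card_fin, nsmul_eq_mul]
  push_cast; ring

/-- THE LATTICE FLOOR CONSTANT `c(q, d, M) = (2^{M+1} q^{Σ_{m ≤ M} m})⁻¹ · (2M / ((M + 1) d))^M`
(`d = deg h = 2g`; equals `½ q^{-M(M+1)/2} (M / (2g(M+1)))^M`, FFCAL.md §3 B2). [folklore] -/
def latticeFloor (q d M : ℕ) : ℝ :=
  ((2 : ℝ) ^ (M + 1) * (q : ℝ) ^ (∑ m : Fin (M + 1), (m : ℕ)))⁻¹ * ((2 * M : ℝ) / ((M + 1) * d)) ^ M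

/-- LATTICE FLOOR, Loewner form, from definiteness alone: MONIC `h ∈ ℤ[x]`, `q ≥ 1`, `T_M(q, h) ≻ 0`
⇒ `T_M(q, h) - c(q, deg h, M) · 1 ⪰ 0`, `c = latticeFloor q (deg h) M`. [folklore] -/
theorem weilWindowForm_sub_latticeFloor_posSemidef_of_posDef {q : ℕ} (hq : 0 < q) {h : ℤ[X]}
    (hmon : h.Monic) {M : ℕ} (hpd : (weilWindowForm q h M).PosDef) :
    (weilWindowForm q h M - (latticeFloor q h.natDegree M : ℂ) • (1 : Matrix _ _ ℂ)).PosSemidef := by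
  classical
  refine posSemidef_sub_smul_one_of_le_eigenvalues hpd.1 fun i => ?_
  refine le_trans ?_ (prod_mul_pow_le_eigenvalues hpd i)
  have hdetC : (weilWindowForm (q : ℝ) h M).det = ((∏ j, hpd.1.eigenvalues j : ℝ) : ℂ) := by
    rw [hpd.1.det_eq_prod_eigenvalues]; push_cast; rfl
  have htrC : (weilWindowForm (q : ℝ) h M).trace = ((∑ j, hpd.1.eigenvalues j : ℝ) : ℂ) := by
    rw [hpd.1.trace_eq_sum_eigenvalues]; push_cast; rfl
  have hdet : (weilWindowForm (q : ℝ) h M).det.re = ∏ j, hpd.1.eigenvalues j := by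
    rw [hdetC, Complex.ofReal_re]
  have htr' : (weilWindowForm (q : ℝ) h M).trace = (M + 1 : ℂ) * (h.natDegree : ℂ) / 2 := by
    have hw : weilWindowForm (q : ℝ) h M = ffWindowForm q (frobRoots h) M := rfl
    rw [hw, trace_ffWindowForm, card_frobRoots_eq_natDegree]
  have htr : ∑ j, hpd.1.eigenvalues j = (M + 1 : ℝ) * h.natDegree / 2 := by
    have h2 : ((∑ j, hpd.1.eigenvalues j : ℝ) : ℂ) = (((M + 1 : ℝ) * h.natDegree / 2 : ℝ) : ℂ) := by
      rw [← htrC, htr']; push_cast; ring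
    exact_mod_cast h2
  obtain ⟨hfloor, -⟩ := one_le_det_weilWindowForm_mul_of_posDef hq hmon hpd
  rw [hdet] at hfloor
  rw [htr]
  have hprod_ge : ((2 : ℝ) ^ (M + 1) * (q : ℝ) ^ (∑ m : Fin (M + 1), (m : ℕ)))⁻¹
      ≤ ∏ j, hpd.1.eigenvalues j := by
    have hc2 : (0 : ℝ) < (2 : ℝ) ^ (M + 1) * (q : ℝ) ^ (∑ m : Fin (M + 1), (m : ℕ)) := by positivity
    rw [inv_le_iff_one_le_mul₀ hc2]
    calc (1 : ℝ) ≤ (q : ℝ) ^ (∑ m : Fin (M + 1), (m : ℕ)) * 2 ^ (M + 1) * ∏ j, hpd.1.eigenvalues j :=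
          hfloor
      _ = _ := by ring
  have hratio : ((2 * M : ℝ) / ((M + 1) * h.natDegree)) = (M : ℝ) / ((M + 1 : ℝ) * h.natDegree / 2) := by
    rw [div_div_eq_mul_div]; ring
  unfold latticeFloor
  rw [hratio]
  exact mul_le_mul_of_nonneg_right hprod_ge (by positivity)

/-- THE LATTICE FLOOR (FFCAL.md §3 B2, Loewner form): MONIC `h ∈ ℤ[x]`, all roots of absolute value `√q`
and pairwise distinct, `M + 1 ≤ deg h` ⇒ `T_M(q, h) - c(q, deg h, M) · 1 ⪰ 0`. [folklore] -/
theorem weilWindowForm_sub_latticeFloor_posSemidef {q : ℕ} (hq : 0 < q) {h : ℤ[X]} (hmon : h.Monic)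
    (hRH : ∀ α ∈ frobRoots h, ‖α‖ = Real.sqrt q) (hnodup : (frobRoots h).Nodup)
    {M : ℕ} (hM : M + 1 ≤ h.natDegree) :
    (weilWindowForm q h M - (latticeFloor q h.natDegree M : ℂ) • (1 : Matrix _ _ ℂ)).PosSemidef :=
  weilWindowForm_sub_latticeFloor_posSemidef_of_posDef hq hmon
    (weilWindowForm_posDef (by exact_mod_cast hq) hRH hnodup hM)

/-- THE LATTICE FLOOR ON EVERY PRE-CLIFF WINDOW (determinant form): MONIC `h ∈ ℤ[x]`, `q ≥ 1`, all roots
of absolute value `√q`, `M + 1 ≤ D` (`D` = number of DISTINCT roots) ⇒ `1 ≤ q^{Σ m} · 2^{M+1} · det T_M`. -/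
theorem one_le_det_weilWindowForm_mul_of_le_card {q : ℕ} (hq : 0 < q) {h : ℤ[X]} (hmon : h.Monic)
    (hRH : ∀ α ∈ frobRoots h, ‖α‖ = Real.sqrt q) {M : ℕ} (hM : M + 1 ≤ (frobRoots h).toFinset.card) :
    1 ≤ (q : ℝ) ^ (∑ m : Fin (M + 1), (m : ℕ)) * 2 ^ (M + 1) * (weilWindowForm q h M).det.re
      ∧ (weilWindowForm q h M).det.im = 0 :=
  one_le_det_weilWindowForm_mul_of_posDef hq hmon
    ((weilWindowForm_posDef_iff (by exact_mod_cast hq) hRH).2 hM)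

/-- THE LATTICE FLOOR ON EVERY PRE-CLIFF WINDOW (Loewner form): under the same hypotheses
`T_M(q, h) - latticeFloor q (deg h) M · 1 ⪰ 0` — an ARITHMETIC floor under `ε₁` of every pre-cliff window,
repeated eigenvalues or not; `M + 1 ≤ D` is sharp (`weilWindowForm_det_eq_zero_iff`). [folklore] -/
theorem weilWindowForm_sub_latticeFloor_posSemidef_of_le_card {q : ℕ} (hq : 0 < q) {h : ℤ[X]}
    (hmon : h.Monic) (hRH : ∀ α ∈ frobRoots h, ‖α‖ = Real.sqrt q)
    {M : ℕ} (hM : M + 1 ≤ (frobRoots h).toFinset.card) :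
    (weilWindowForm q h M - (latticeFloor q h.natDegree M : ℂ) • (1 : Matrix _ _ ℂ)).PosSemidef :=
  weilWindowForm_sub_latticeFloor_posSemidef_of_posDef hq hmon
    ((weilWindowForm_posDef_iff (by exact_mod_cast hq) hRH).2 hM)

end Summit.RiemannHypothesis.RiemannHypothesis.Theorems.MotivicDoor.FfLatticeFloor

end
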